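import Mathlib.NumberTheory.LSeries.DirichletContinuation
import Mathlib.NumberTheory.ArithmeticFunction.Moebius
import Mathlib.MeasureTheory.Integral.IntervalIntegral.Basic
import Mathlib.Analysis.SpecialFunctions.Pow.Complex
import HarnessLib

/-!
# The `θ = ∞` criterion for Dirichlet `L`-functions (Dong–Wattanawanichkul–Zaharescu 2026,
# Theorems 1.1 and 1.3, case `m = 1`)

Topic `Literature/NumberTheory/LFunctions` (namespace `Literature.NumberTheory.LFunctions`).
STATEMENT LAYER (D-0014: sorry-free named `Prop` facts, nothing asserted), typed for the
LANDAU–SIEGEL PROGRAMME (cell `landau-siegel`, §C harvest topic r4, HOME/lit/r4/ROWS.md r4-P08 /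
r4-T10): the GL(m) extension of Bettin–Gonek's theorem "the `θ = ∞` conjecture implies RH"
(tree: `Literature.Barriers.RiemannHypothesis.BettinGonek2017_thm1/thm2`, CITED not retyped), in
its `m = 1` case = primitive Dirichlet characters (including `ζ` as the character mod `1`). Its use
in the programme is a PRICING RULE (ls-ref-1 PROTOCOL v0.3 §2): a hypothetical long-mollifier
mean-value bound of this strength is itself a zero-free-region theorem — the source remarks that
such a bound "prohibits the existence of possible Landau–Siegel zeros" (§1, after Theorem 1.3).
The programme SEARCHES and TYPES; no claim about Landau–Siegel zeros is made here.

## Source (arXiv TeX, read 2026-08-26)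

A. Dong, N. Wattanawanichkul, A. Zaharescu, *The `θ = ∞` conjecture and the Riemann Hypothesis
for automorphic `L`-functions*, arXiv:2605.24363 (2026) [bib: `DongWattanawanichkulZaharescu2026`].
Setting (§1): `π ∈ 𝔉_m` cuspidal on `GL_m(𝔸_ℚ)` with unitary normalised central character,
`L(s, π) = Σ λ_π(n) n^{−s}`, `1/L(s, π) = Σ μ_π(n) n^{−s}`; for `x > 0` the mollifier `M_{x,π}` is
defined by `M_{x,π}(s) log x = Σ_{n ≤ x} μ_π(n) n^{−s} log(x/n)`, `M_{1,π} = 0` (so `M_{x,π} = 0` for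
`0 < x ≤ 1`); `I_{y,π}(T₁, T₂) = ∫_{T₁}^{T₂} |M_{y,π}(1/2+it) L(1/2+it, π)|² dt`.

* **Theorem 1.1.** "Let `m ∈ ℕ` and `π ∈ 𝔉_m`. Let `θ > 0`, `σ ≥ 1/2`, and `1/2 > ε > 0` be fixed.
  There exists a constant `C := C(π, θ, σ, ε) > 0` with the following property: For any `T₂ ≥ 1`,
  `0 ≤ T₁ ≤ T₂/2`, … for which `∫₁^{T₂^θ} I_{y,π}(T₁, T₂) dy ≤ C T₂^{2σθ − 5 − 2m}`, the `L`-function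
  `L(s, π)` does not vanish in the rectangle defined by `Re(s) > σ + ε` and `T₁ ≤ Im(s) ≤ T₂`."
* **Theorem 1.3.** "Let `θ > 0` and `σ ≥ 1/2` be fixed. Suppose that
  `sup_{T ∈ [1,∞)} T^{−2σθ} ∫₁^{T^θ} I_{y,π}(0, T) dy < ∞`. Then `L(s, π)` does not vanish in the
  half-plane `Re(s) > σ`."
* (Not typed: Corollary 1.5 — the `(1+ε)θ` version giving RH for `L(s, π)`; Theorem 1.8 — the
  FAMILY version `Σ_{π ∈ 𝓕} ∫₁^{T^θ} I_{y,π}(0,T) dy ≪_δ |𝓕| T^{2σθ−δ} ⇒ N(σ,0,T;𝓕)/|𝓕| ≪_ε T^{−δ+ε}`,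
  whose uniformity in the family `𝓕` is not explicit enough in print to type without a choice.)

## The case `m = 1` (what is typed) and rendering choices

`𝔉_1` = primitive Dirichlet characters `χ` mod `N ≥ 1` (the character mod `1` giving `ζ`), with
`λ_π = χ`, `μ_π(n) = μ(n) χ(n)`, `L(s, π) = L(s, χ)` = Mathlib's `DirichletCharacter.LFunction χ s`
(which is `riemannZeta` for `N = 1`). `TODO(general form)`: `m ≥ 2` needs automorphic
`L`-functions, absent from Mathlib. "Does not vanish" is stated for `s ≠ 1` (for `N = 1` the point
`s = 1` is the pole of `ζ`, where Mathlib's `LFunction` carries a junk value; for `N > 1`,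
`L(1, χ) ≠ 0` is classical) — this removes nothing printed. "`sup … < ∞`" = "`∃ B, ∀ T ≥ 1, … ≤ B`".
The `y`-integral of the non-negative `I_{y,χ}` is a Lebesgue interval integral over `[1, T^θ]`.

## References
* [DongWattanawanichkulZaharescu2026] §1: Theorems 1.1, 1.3, Corollary 1.5, Theorem 1.8, Remarks
  1.2, 1.4 (the Landau–Siegel sentence), 1.6–1.7.
* [BettinGonek2017] Theorems 1–2 — tree `Literature/Barriers/RiemannHypothesis/MollifierLimitations.lean`.
-/

noncomputable section

open Complex MeasureTheory
open scoped ArithmeticFunction.Moebius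

namespace Literature.NumberTheory.LFunctions

namespace DWZ2026

/-- The mollifier `M_{x,χ}(s) = (1/log x) Σ_{n ≤ x} μ(n) χ(n) n^{−s} log(x/n)` for `x > 1`, and
`M_{x,χ} = 0` for `x ≤ 1` (`μ_π(n) = μ(n)χ(n)` are the coefficients of `1/L(s, χ)`).
[cite: DongWattanawanichkulZaharescu2026, §1 (definition of M_{x,π})] -/
def mollifier {N : ℕ} (χ : DirichletCharacter ℂ N) (x : ℝ) (s : ℂ) : ℂ :=
  if x ≤ 1 then 0
  else
    ∑ n ∈ Finset.Icc 1 ⌊x⌋₊,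
      ((μ n : ℤ) : ℂ) * χ (n : ZMod N) * (n : ℂ) ^ (-s) * ((Real.log (x / n) / Real.log x : ℝ) : ℂ)

/-- The mollified second moment `I_{y,χ}(T₁, T₂) = ∫_{T₁}^{T₂} |M_{y,χ}(1/2+it) L(1/2+it, χ)|² dt`.
[cite: DongWattanawanichkulZaharescu2026, §1 (1.1)] -/
def mollifiedMoment {N : ℕ} [NeZero N] (χ : DirichletCharacter ℂ N) (y T₁ T₂ : ℝ) : ℝ :=
  ∫ t in T₁..T₂, ‖mollifier χ y (1 / 2 + t * I) * χ.LFunction (1 / 2 + t * I)‖ ^ 2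

/-- The length-averaged moment `∫₁^{X} I_{y,χ}(T₁, T₂) dy` (used with `X = T^θ`).
[cite: DongWattanawanichkulZaharescu2026, Theorem 1.1] -/
def averagedMoment {N : ℕ} [NeZero N] (χ : DirichletCharacter ℂ N) (X T₁ T₂ : ℝ) : ℝ :=
  ∫ y in (1 : ℝ)..X, mollifiedMoment χ y T₁ T₂

end DWZ2026

open DWZ2026

/-- **Dong–Wattanawanichkul–Zaharescu 2026, Theorem 1.1, case `m = 1`** (local version, NAMED
FACT): for a primitive Dirichlet character `χ` mod `N ≥ 1`, `θ > 0`, `σ ≥ 1/2`, `0 < ε < 1/2`,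
there is `C = C(χ, θ, σ, ε) > 0` such that for all `T₂ ≥ 1`, `0 ≤ T₁ ≤ T₂/2`: if
`∫₁^{T₂^θ} I_{y,χ}(T₁,T₂) dy ≤ C · T₂^{2σθ − 7}` (`= 2σθ − 5 − 2m` at `m = 1`), then `L(s, χ) ≠ 0`
for `Re s > σ + ε`, `T₁ ≤ Im s ≤ T₂` (`s ≠ 1`). `TODO(general form): m ≥ 2`. Status: preprint claim,
unrefereed arXiv (2026) [claim: DongWattanawanichkulZaharescu2026, status: under-review].
[cite: DongWattanawanichkulZaharescu2026, Theorem 1.1] -/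
def dongWattanawanichkulZaharescu2026_theorem11_dirichlet : Prop :=
  ∀ (N : ℕ) [NeZero N] (χ : DirichletCharacter ℂ N), χ.IsPrimitive →
    ∀ θ σ ε : ℝ, 0 < θ → 1 / 2 ≤ σ → 0 < ε → ε < 1 / 2 →
      ∃ C : ℝ, 0 < C ∧ ∀ T₁ T₂ : ℝ, 1 ≤ T₂ → 0 ≤ T₁ → T₁ ≤ T₂ / 2 →
        averagedMoment χ (T₂ ^ θ) T₁ T₂ ≤ C * T₂ ^ (2 * σ * θ - 7) →
          ∀ s : ℂ, σ + ε < s.re → T₁ ≤ s.im → s.im ≤ T₂ → s ≠ 1 → χ.LFunction s ≠ 0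

/-- **Dong–Wattanawanichkul–Zaharescu 2026, Theorem 1.3, case `m = 1`** (NAMED FACT): for a
primitive Dirichlet character `χ` mod `N ≥ 1`, `θ > 0`, `σ ≥ 1/2`: if
`sup_{T ≥ 1} T^{−2σθ} ∫₁^{T^θ} I_{y,χ}(0, T) dy < ∞`, then `L(s, χ) ≠ 0` for `Re s > σ` (`s ≠ 1`).
For `σ ≤ 1 − δ` this excludes in particular a Landau–Siegel zero of `L(s, χ)` (the source's remark
after Theorem 1.3). `TODO(general form): m ≥ 2`. Status: preprint claim, unrefereed arXiv (2026)
[claim: DongWattanawanichkulZaharescu2026, status: under-review].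
[cite: DongWattanawanichkulZaharescu2026, Theorem 1.3] -/
def dongWattanawanichkulZaharescu2026_theorem13_dirichlet : Prop :=
  ∀ (N : ℕ) [NeZero N] (χ : DirichletCharacter ℂ N), χ.IsPrimitive →
    ∀ θ σ : ℝ, 0 < θ → 1 / 2 ≤ σ →
      (∃ B : ℝ, ∀ T : ℝ, 1 ≤ T → T ^ (-(2 * σ * θ)) * averagedMoment χ (T ^ θ) 0 T ≤ B) →
        ∀ s : ℂ, σ < s.re → s ≠ 1 → χ.LFunction s ≠ 0

/-! ### Bookkeeping (proved) -/

/-- The mollifier vanishes for lengths `x ≤ 1` ("`M_{x,π}(s) = 0` for `0 < x ≤ 1`").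
[cite: DongWattanawanichkulZaharescu2026, §1 (after (1.2))] -/
theorem DWZ2026.mollifier_of_le_one {N : ℕ} (χ : DirichletCharacter ℂ N) {x : ℝ} (hx : x ≤ 1)
    (s : ℂ) : mollifier χ x s = 0 := by
  simp [mollifier, hx]

/-- The exponent of Theorem 1.1 at `m = 1`: `2σθ − 5 − 2m = 2σθ − 7`.
[cite: DongWattanawanichkulZaharescu2026, Theorem 1.1] -/
theorem DWZ2026.exponent_m_one (σ θ : ℝ) : 2 * σ * θ - 5 - 2 * (1 : ℝ) = 2 * σ * θ - 7 := by ring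

/-- Theorem 1.3 at `σ = 1/2`: a bound `T^{−θ} ∫₁^{T^θ} I_{y,χ}(0,T) dy ≤ B` for ONE `θ > 0` already
gives the Riemann hypothesis for `L(s, χ)` off the point `s = 1` (the `m = 1` reading of the
source's Corollary 1.5 / Remark 1.6 direction "`θ = ∞` ⇒ RH").
[cite: DongWattanawanichkulZaharescu2026, Theorem 1.3 and Corollary 1.5] -/
theorem dongWattanawanichkulZaharescu2026_theorem13_dirichlet.half
    (h : dongWattanawanichkulZaharescu2026_theorem13_dirichlet) (N : ℕ) [NeZero N]
    (χ : DirichletCharacter ℂ N) (hχ : χ.IsPrimitive) (θ : ℝ) (hθ : 0 < θ)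
    (hB : ∃ B : ℝ, ∀ T : ℝ, 1 ≤ T → T ^ (-(2 * (1 / 2 : ℝ) * θ)) * averagedMoment χ (T ^ θ) 0 T ≤ B)
    (s : ℂ) (hs : 1 / 2 < s.re) (hs1 : s ≠ 1) : χ.LFunction s ≠ 0 :=
  h N χ hχ θ (1 / 2) hθ le_rfl hB s hs hs1

end Literature.NumberTheory.LFunctions
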